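/-
Copyright (c) 2026 the pub-hodgecm-mathlib formalisation cell (harness21).  Prover seat hodgecm-mathlib-A-p12 (g27), free A hand plated onto
line LD1 (organ (Gα-C∞) `ArchLadder`, A-p16 (g35) a014 sign lemmas (σ1), (σ2), `hcov`), 2026-09-02.
THEOREMS ONLY (no definition, no named fact, no `sorry`, no instance, no notation).  `--supports stmt-HodgeConjecture-24832 --as helper`.
-/
import Summits.HodgeConjecture.HodgeConjecture.Theorems.F0LD2ArchSignAt
import HarnessLib

/-!
# The SIGN CLASSES of the frame coordinates for the `ArchLadder` head: constant sign off the place of `ι` (σ1), one positive and one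
# non-positive coordinate at the place of `ι` (σ2), and the two-coordinate cover of `Fin n′` in rank 2 (`hcov`)

Cell hodgecm-mathlib FLOOR 0, programme P6, line LD1 of crux `hLiu418` = `stmt-HodgeConjecture-24832`, organ (Gα-C∞) `ArchLadder` (A-p16 (g35) HEAD
`archLadder_holds`, a014).  Namespace `Summit.HodgeConjecture.HodgeConjecture.Cruxes.HLiu418.F0LD1ThetaArchLadderSigns`.  The sign vector is
`x_v(k) = signVec (cmPlaceOver L) (cmGramEntry L e₁ dV hdV (lineW L (TW L⁺ a)) (complexConj_lineW …)) (imagUnit L) v k = σ_v(dV (e₁⁻¹k)₁) · σ_v(a) ∕ c_v`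
(★ `signVec_cmGramEntry_eq`).

* (σ1) `forall_signVec_pos_or_forall_not_of_ne_iota` — at a real place `v` NOT below `ι`, the letters' binder «`diag dV` is positive definite at every
  embedding off `ι`» (`hdef`) makes all `σ_v(dV p) > 0` (Mathlib `posDef_diagonal_iff`, ★ `realPlaceMap_eq_embedding_of_isReal`), hence `x_v` has
  CONSTANT sign (★ `forall_signVec_pos_or_forall_not_of_line`) — the `hconst` of ★ `F0LD1ThetaArchDefiniteTransitivity`.
* (σ2) `exists_signVec_pos_and_not_pos_of_sig` — at the real place `v₀` below `ι`, the signature-`(1,1)` binder (`hsig`) gives frame coordinates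
  `kp ≠ km` with `0 < x_{v₀}(kp)` and `¬ 0 < x_{v₀}(km)` (★ `exists_neg_pos_of_sig₂`: Sylvester for `2 × 2`; ★ `embedding_algebraMap_eq_embedding_of_isReal`:
  `ι = σ_{v₀}` on `L⁺`).
* `eq_or_eq_of_equiv_two` — `hcov`: every `k : Fin n′` is `e₁(0,0)` or `e₁(1,0)` for `e₁ : Fin 2 × Fin 1 ≃ Fin n′`.

HONEST SCOPE.  Nothing of [Liu2021] is asserted; HC_CM is proved only modulo the 7 printed citations (2 remaining: hLiu418 = stmt-HodgeConjecture-24832,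
h413 = stmt-HodgeConjecture-24833) until rung 0 closes; this file books nothing and discharges nothing booked; count-neutral.

## References (prose locators)
* [Liu2021] Y. Liu, Camb. J. Math. 9 (2021), App. D Lem. D.2 (1)∕(3) (the places off ∕ at `ι`).
* [KonnoKonno2007] K. Konno, T. Konno, Kyushu J. Math. 61 (2007), §3.1 (3.1) (sign vectors).
* [Jacobson] N. Jacobson, *Basic Algebra I*, Ch. V §11 p. 162 (Sylvester's law of inertia).
-/

set_option autoImplicit false
set_option linter.dupNamespace false

noncomputable section

open NumberField NumberField.InfinitePlace
open scoped Matrix ComplexOrder Classical ComplexConjugate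

namespace Summit.HodgeConjecture.HodgeConjecture.Cruxes.HLiu418.F0LD1ThetaArchLadderSigns

open Literature.NumberTheory.Automorphic Literature.NumberTheory.Automorphic.UnitaryGroup
open Literature.NumberTheory.Automorphic.Liu2021
open Literature.NumberTheory.Automorphic.Liu2021.Def411WeilCarriers Literature.NumberTheory.Automorphic.Liu2021.Def411WeilCarriersDoubling
open Literature.NumberTheory.GelbartRogawski1991 Literature.NumberTheory.GelbartRogawski1991.UnitaryDualPair
open Literature.NumberTheory.GelbartRogawski1991.GRConstruction Literature.NumberTheory.Weil1964
open Summit.HodgeConjecture.HodgeConjecture.Cruxes.HLiu418.F0LD2ArchSignAt (exists_neg_pos_of_sig₂)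

variable (L : Type) [Field L] [NumberField L] [IsCMField L] {N n' : ℕ} (e₁ : Fin N × Fin 1 ≃ Fin n') (dV : Fin N → L)
  (hdV : ∀ i, IsCMField.complexConj L (dV i) = dV i) (a : (↥(maximalRealSubfield L))ˣ) (ι : L →+* ℂ)

/-! ## (σ1) Constant sign off the place of `ι` -/

/-- **(σ1) CONSTANT SIGN OFF THE PLACE OF `ι`.**  If `diag dV` is positive definite at every complex embedding off the place of `ι` (the letters' `hdef`),
then at every real place `v` of `L⁺` NOT below `ι` the sign vector of the frame coordinates is of constant sign:
`(∀ k, 0 < x_v(k)) ∨ (∀ k, ¬ 0 < x_v(k))` — the `hconst` of ★ `F0LD1ThetaArchDefiniteTransitivity`. (Liu2021, App. D Lem. D.2 (1)) (KonnoKonno2007, §3.1) -/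
theorem forall_signVec_pos_or_forall_not_of_ne_iota
    (hdef : ∀ τ' : L →+* ℂ, InfinitePlace.mk τ' ≠ InfinitePlace.mk ι → ((Matrix.diagonal dV).map τ').PosDef)
    (v : {v : InfinitePlace (↥(maximalRealSubfield L)) // v.IsReal})
    (hv : (InfinitePlace.mk ι).comap (algebraMap (↥(maximalRealSubfield L)) L) ≠ v.1) :
    (∀ k : Fin n', 0 < signVec (cmPlaceOver L) (cmGramEntry L e₁ dV hdV (lineW L (TW (Fp L) a)) (complexConj_lineW L (TW (Fp L) a))) (imagUnit L) v k) ∨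
      (∀ k : Fin n', ¬ 0 < signVec (cmPlaceOver L) (cmGramEntry L e₁ dV hdV (lineW L (TW (Fp L) a)) (complexConj_lineW L (TW (Fp L) a))) (imagUnit L) v k) := by
  -- the complex place over `v` is not the place of `ι`
  have hne : InfinitePlace.mk (cmPlaceOver L v).1.embedding ≠ InfinitePlace.mk ι := by
    intro h
    rw [mk_embedding] at h
    exact hv (by rw [← h, cmPlaceOver_comap])
  have hH := hdef _ hne
  -- `σ_v(dV p) > 0` for every `p`
  have hVpos : ∀ p : Fin N, 0 < embedding_of_isReal v.2 (⟨dV p, (IsCMField.complexConj_eq_self_iff (K := L) (dV p)).1 (hdV p)⟩ : Fp L) := by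
    intro p
    have h2 := hH
    rw [Matrix.diagonal_map (map_zero _)] at h2
    have h3 := (Matrix.posDef_diagonal_iff.1 h2) p
    rw [Complex.pos_iff] at h3
    have h4 := realPlaceMap_eq_embedding_of_isReal L (IsCMField.complexConj L) (cmPlaceOver L v) (cmPlaceOver_smul L v)
      (IsCMField.complexConj_ne_one L) v (cmPlaceOver_comap L v)
      (⟨dV p, (IsCMField.complexConj_eq_self_iff (K := L) (dV p)).1 (hdV p)⟩ : Fp L)
    rw [← h4]
    exact h3.1
  exact forall_signVec_pos_or_forall_not_of_line L dV hdV v e₁ (lineW L (TW (Fp L) a)) (complexConj_lineW L (TW (Fp L) a)) hVpos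

/-! ## (σ2) One positive and one non-positive coordinate at the place of `ι` -/

/-- **(σ2) AT THE PLACE OF `ι`: ONE POSITIVE, ONE NON-POSITIVE FRAME COORDINATE.**  In rank 2, if `diag dV` has signature `(1,1)` at `ι` (the letters' `hsig`)
and `v₀` is the real place below `ι`, then there are frame coordinates `kp ≠ km` with `0 < x_{v₀}(kp)` and `¬ 0 < x_{v₀}(km)` (Sylvester for `2 × 2`,
★ `exists_neg_pos_of_sig₂`; `ι = σ_{v₀}` on `L⁺`, ★ `embedding_algebraMap_eq_embedding_of_isReal`; `x_{v₀}(e₁(p,0)) = σ_{v₀}(dV p) · s`, `s = σ_{v₀}(a)∕c_{v₀} ≠ 0`,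
★ `signVec_cmGramEntry_eq`). (Liu2021, App. D Lem. D.2 (3)) (Jacobson, Ch. V §11 p. 162) -/
theorem exists_signVec_pos_and_not_pos_of_sig (e₁ : Fin 2 × Fin 1 ≃ Fin n') (dV : Fin 2 → L)
    (hdV : ∀ i, IsCMField.complexConj L (dV i) = dV i)
    (hsig : ∃ T : GL (Fin 2) ℂ, formCongr (starRingEnd ℂ) T ((Matrix.diagonal dV).map ι) = Matrix.diagonal ![(1 : ℂ), -1])
    (v₀ : {v : InfinitePlace (↥(maximalRealSubfield L)) // v.IsReal})
    (hv₀ : (InfinitePlace.mk ι).comap (algebraMap (↥(maximalRealSubfield L)) L) = v₀.1) :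
    ∃ kp km : Fin n', kp ≠ km ∧
      0 < signVec (cmPlaceOver L) (cmGramEntry L e₁ dV hdV (lineW L (TW (Fp L) a)) (complexConj_lineW L (TW (Fp L) a))) (imagUnit L) v₀ kp ∧
      ¬ 0 < signVec (cmPlaceOver L) (cmGramEntry L e₁ dV hdV (lineW L (TW (Fp L) a)) (complexConj_lineW L (TW (Fp L) a))) (imagUnit L) v₀ km := by
  obtain ⟨T, hT⟩ := hsig
  rw [Matrix.diagonal_map (map_zero _)] at hT
  obtain ⟨pm, pp, hpp, hneg, hpos⟩ := exists_neg_pos_of_sig₂ (fun i => ι (dV i)) T hT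
  -- `ι(dV p) = σ_{v₀}(dV p)` (real)
  have hre : ∀ p : Fin 2, (ι (dV p)).re =
      embedding_of_isReal v₀.2 (⟨dV p, (IsCMField.complexConj_eq_self_iff (K := L) (dV p)).1 (hdV p)⟩ : Fp L) := fun p => by
    have h := embedding_algebraMap_eq_embedding_of_isReal L v₀ ι hv₀ (⟨dV p, (IsCMField.complexConj_eq_self_iff (K := L) (dV p)).1 (hdV p)⟩ : Fp L)
    rw [show algebraMap (↥(maximalRealSubfield L)) L (⟨dV p, (IsCMField.complexConj_eq_self_iff (K := L) (dV p)).1 (hdV p)⟩ : Fp L) = dV p from rfl] at h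
    rw [h, Complex.ofReal_re]
  rw [hre] at hneg hpos
  -- the common factor `s := σ_{v₀}(dW 0) / c_{v₀}` and the factorisation of the sign vector
  set s : ℝ := embedding_of_isReal v₀.2 (⟨lineW L (TW (Fp L) a) 0,
      (IsCMField.complexConj_eq_self_iff (K := L) (lineW L (TW (Fp L) a) 0)).1 (complexConj_lineW L (TW (Fp L) a) 0)⟩ : Fp L) /
    deltaIm (cmPlaceOver L) (imagUnit L) v₀ with hs
  have hfac : ∀ p : Fin 2, signVec (cmPlaceOver L) (cmGramEntry L e₁ dV hdV (lineW L (TW (Fp L) a)) (complexConj_lineW L (TW (Fp L) a))) (imagUnit L) v₀ (e₁ (p, 0)) =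
      embedding_of_isReal v₀.2 (⟨dV p, (IsCMField.complexConj_eq_self_iff (K := L) (dV p)).1 (hdV p)⟩ : Fp L) * s := fun p => by
    rw [signVec_cmGramEntry_eq, mul_div_assoc, Equiv.symm_apply_apply]
  have hinj : e₁ (pp, 0) ≠ e₁ (pm, 0) := fun h => hpp (congrArg Prod.fst (e₁.injective h))
  rcases lt_trichotomy s 0 with hs0 | hs0 | hs0
  · refine ⟨e₁ (pm, 0), e₁ (pp, 0), hinj.symm, ?_, ?_⟩
    · rw [hfac]; exact mul_pos_of_neg_of_neg hneg hs0
    · rw [hfac, not_lt]; exact (mul_neg_of_pos_of_neg hpos hs0).le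
  · -- `s = 0` is impossible (`a ≠ 0`, `c_{v₀} ≠ 0`), but the conclusion needs no case analysis: both signs vanish — use `pp`, `pm` with `0 < 0` false.
    exfalso
    have ha0 : embedding_of_isReal v₀.2 (⟨lineW L (TW (Fp L) a) 0,
        (IsCMField.complexConj_eq_self_iff (K := L) (lineW L (TW (Fp L) a) 0)).1 (complexConj_lineW L (TW (Fp L) a) 0)⟩ : Fp L) ≠ 0 := by
      rw [map_ne_zero_iff _ (embedding_of_isReal v₀.2).injective]
      exact fun h => lineW_ne_zero L (TW (Fp L) a) (isUnit_det_TW (Fp L) a) 0 (congrArg Subtype.val h)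
    exact (div_ne_zero ha0 (deltaIm_ne_zero (IsCMField.complexConj_ne_one L) (cmPlaceOver_smul L) (complexConj_imagUnit L) (imagUnit_ne_zero L) v₀)) hs0
  · refine ⟨e₁ (pp, 0), e₁ (pm, 0), hinj, ?_, ?_⟩
    · rw [hfac]; exact mul_pos hpos hs0
    · rw [hfac, not_lt]; exact (mul_neg_of_neg_of_pos hneg hs0).le

/-! ## `hcov`: the two frame coordinates cover `Fin n′` in rank 2 -/

omit [NumberField L] [IsCMField L] in
/-- **`hcov`**: for `e₁ : Fin 2 × Fin 1 ≃ Fin n′` every `k : Fin n′` is `e₁(0,0)` or `e₁(1,0)`. (KonnoKonno2007, §3.1) -/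
theorem eq_or_eq_of_equiv_two (e₁ : Fin 2 × Fin 1 ≃ Fin n') (k : Fin n') : k = e₁ (0, 0) ∨ k = e₁ (1, 0) := by
  obtain ⟨⟨p, q⟩, rfl⟩ := e₁.surjective k
  obtain rfl : q = 0 := Subsingleton.elim _ _
  rcases Fin.exists_fin_two.mp ⟨p, rfl⟩ with h | h
  · exact Or.inl (by rw [h])
  · exact Or.inr (by rw [h])

end Summit.HodgeConjecture.HodgeConjecture.Cruxes.HLiu418.F0LD1ThetaArchLadderSigns

end
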